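import Mathlib
import HarnessLib

/-!
# Route `PhantomRMYoshida`, crux `StableYoshidaCongruence` (stmt-Langlands-13640), line
# `paramodular-purity-torsion-locus`: Stub 2 `stub_rankPropagation`

Pure commutative algebra, Mathlib only.  The line models the `𝔪`-localised Klingen higher-Hida
complex as a two-term complex `[M --d--> N]` of finite free modules over a principal ideal domain
`R`, with "weight elements" `ϖ m` (`m ∈ W ⊆ ℕ`), pairwise coprime non-units.  A POINT of the
complex at `π ∈ R` is an `x ∈ M` with `x ∉ π M` and `d x ∈ π N`, spelled
`(¬ ∃ y, x = π • y) ∧ ∃ z, d x = π • z`.  The registered stub `stub_rankPropagation` says: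

  points at infinitely many of the pairwise coprime `ϖ m` ⇒ a point at EVERY non-unit `π`
  (`π = 0` included).

Proof.
* If `d` is injective there are only finitely many such `m`: a point `x` at `ϖ = ϖ m` gives
  `d x = ϖ • z` with `z ∉ d(M)` (else `x ∈ ϖ M` by injectivity), so the class of `z` in the
  cokernel `N ⧸ d(M)` is a non-zero `ϖ`-torsion element.  The torsion submodule of the finitely
  generated module `N ⧸ d(M)` over the Noetherian domain `R` is finitely generated, hence killed by
  one `a ≠ 0` (`Submodule.annihilator_top_inter_nonZeroDivisors`); a Bézout relation
  `u ϖ + v a = 1` would kill the class of `z`, so `ϖ m` is NOT coprime to `a`, i.e. (PID) some prime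
  factor of `a` divides `ϖ m` (`isCoprime_of_prime_dvd`).  That prime is associated to a member of
  the finite multiset `UniqueFactorizationMonoid.factors a`, and pairwise coprimality of the `ϖ m`
  makes `m ↦` (that member) injective — impossible on an infinite set
  (`Set.Infinite.exists_ne_map_eq_of_mapsTo`).
* Hence `ker d ≠ ⊥`.  As a submodule of the finite free module `M` over a PID it is free
  (`Submodule.basisOfPid`) and non-trivial, so it has a basis vector `e`.  For a non-unit `π`,
  `e` is a point at `π`: `d e = 0 = π • 0`, and `e = π • y` forces (`π = 0` being absurd as
  `e ≠ 0`) `d y = 0` since `N` is torsion-free, so `y ∈ ker d` and comparing `e`-coordinates in the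
  free module `ker d` gives `1 = π * _`, i.e. `π` is a unit.

The hypothesis "`ϖ m` is a non-unit" of the registered signature is not needed (a point at a unit
cannot exist), but the signature is proved verbatim.  No named facts, no definitions.
-/

-- `Summit.Langlands.Langlands.…` (summit = sub-problem name, D-0017 layout) trips `dupNamespace` on every decl.
set_option linter.dupNamespace false

noncomputable section

open Module

namespace Summit.Langlands.Langlands.Cruxes.StableYoshidaCongruence.ParamodularPurityTorsionLocus

/-- **Finiteness of the non-coprime locus.**  In a principal ideal domain, if `a ≠ 0` and the
elements `ϖ m`, `m ∈ W`, are pairwise coprime, then a set `S ⊆ W` on which every `ϖ m` fails to be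
coprime to `a` cannot be infinite: each such `ϖ m` is divisible by a prime factor of `a`
(`isCoprime_of_prime_dvd`), which is associated to one of the finitely many members of
`UniqueFactorizationMonoid.factors a`; by the pigeonhole principle two distinct `m ≠ m'` in `S`
share one, contradicting `IsCoprime (ϖ m) (ϖ m')`. [folklore] -/
theorem false_of_infinite_not_isCoprime {R : Type} [CommRing R] [IsDomain R]
    [IsPrincipalIdealRing R] {W S : Set ℕ} {ϖ : ℕ → R} {a : R} (ha0 : a ≠ 0) (hSW : S ⊆ W)
    (hcop : ∀ m ∈ W, ∀ m' ∈ W, m ≠ m' → IsCoprime (ϖ m) (ϖ m'))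
    (hS : S.Infinite) (hnc : ∀ m ∈ S, ¬ IsCoprime (ϖ m) a) : False := by
  have hq : ∀ m ∈ S, ∃ q ∈ UniqueFactorizationMonoid.factors a, q ∣ ϖ m := by
    intro m hm
    by_contra h
    push Not at h
    refine hnc m hm (isCoprime_of_prime_dvd (fun h0 => ha0 h0.2) fun p hp hpm hpa => ?_)
    obtain ⟨q, hq, hpq⟩ :=
      UniqueFactorizationMonoid.exists_mem_factors_of_dvd ha0 hp.irreducible hpa
    exact h q hq (hpq.symm.dvd.trans hpm)
  choose! g hg hg' using hq
  obtain ⟨m, hm, m', hm', hne, heq⟩ := hS.exists_ne_map_eq_of_mapsTo (f := g)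
    (t := {q | q ∈ UniqueFactorizationMonoid.factors a}) (fun n hn => hg n hn)
    (UniqueFactorizationMonoid.factors a).finite_toSet
  have hc : IsCoprime (g m) (g m) :=
    ((hcop m (hSW hm) m' (hSW hm') hne).of_isCoprime_of_dvd_left (hg' m hm)).of_isCoprime_of_dvd_right
      (heq ▸ hg' m' hm')
  exact (UniqueFactorizationMonoid.irreducible_of_factor _ (hg m hm)).not_isUnit
    (isCoprime_self.mp hc)

/-- **One non-zero element kills all torsion.**  For a finitely generated module `Q` over a
principal ideal domain `R` there is `a ≠ 0` in `R` with `a • q = 0` for every torsion element `q`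
(every `q` killed by some `r ≠ 0`): the torsion submodule is finitely generated (`R` is
Noetherian), so the product of annihilators of its generators works
(`Submodule.annihilator_top_inter_nonZeroDivisors`). [folklore] -/
theorem exists_ne_zero_smul_torsion_eq_zero (R : Type) [CommRing R] [IsDomain R]
    [IsPrincipalIdealRing R] (Q : Type) [AddCommGroup Q] [Module R Q] [Module.Finite R Q] :
    ∃ a : R, a ≠ 0 ∧ ∀ (q : Q) (r : R), r ≠ 0 → r • q = 0 → a • q = 0 := by
  haveI : Module.Finite R (Submodule.torsion R Q) :=
    Module.Finite.iff_fg.mpr (IsNoetherian.noetherian _)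
  obtain ⟨a, ha, ha0⟩ := Submodule.annihilator_top_inter_nonZeroDivisors
    (Submodule.torsion_isTorsion (R := R) (M := Q))
  refine ⟨a, nonZeroDivisors.ne_zero ha0, fun q r hr hrq => ?_⟩
  have hq : q ∈ Submodule.torsion R Q :=
    (Submodule.mem_torsion_iff q).mpr ⟨⟨r, mem_nonZeroDivisors_of_ne_zero hr⟩, hrq⟩
  have h := Submodule.mem_annihilator.mp ha ⟨q, hq⟩ trivial
  exact congrArg Subtype.val h

/-- **Points force non-coprimality (injective case).**  Let `d : M → N` be injective and let
`a ∈ R` kill every torsion element of the cokernel `N ⧸ d(M)`.  If `x ∉ ϖ M` and `d x = ϖ • z`,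
then `ϖ` and `a` are not coprime: for `ϖ = 0` injectivity gives `x = 0 ∈ ϖ M`; otherwise the class
of `z` in `N ⧸ d(M)` is `ϖ`-torsion, hence killed by `a`, and a relation `u ϖ + v a = 1` kills it,
so `z = d y` and `x = ϖ • y` by injectivity. [folklore] -/
theorem not_isCoprime_of_point {R M N : Type} [CommRing R] [AddCommGroup M] [Module R M]
    [AddCommGroup N] [Module R N] {d : M →ₗ[R] N} (hinj : Function.Injective d) {a : R}
    (ha : ∀ (q : N ⧸ LinearMap.range d) (r : R), r ≠ 0 → r • q = 0 → a • q = 0)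
    {ϖ : R} {x : M} (hx : ¬ ∃ y : M, x = ϖ • y) {z : N} (hz : d x = ϖ • z) :
    ¬ IsCoprime ϖ a := by
  rintro ⟨u, v, huv⟩
  apply hx
  by_cases h0 : ϖ = 0
  · refine ⟨0, ?_⟩
    rw [smul_zero]
    apply hinj
    rw [hz, h0, zero_smul, map_zero]
  · have hϖz : ϖ • Submodule.Quotient.mk (p := LinearMap.range d) z = 0 := by
      rw [← Submodule.Quotient.mk_smul, ← hz, Submodule.Quotient.mk_eq_zero]
      exact LinearMap.mem_range_self d x
    have haz : a • Submodule.Quotient.mk (p := LinearMap.range d) z = 0 := ha _ ϖ h0 hϖz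
    have hz0 : Submodule.Quotient.mk (p := LinearMap.range d) z = 0 := by
      calc Submodule.Quotient.mk (p := LinearMap.range d) z
          = (u * ϖ + v * a) • Submodule.Quotient.mk (p := LinearMap.range d) z := by
            rw [huv, one_smul]
        _ = 0 := by
            rw [add_smul, mul_smul, mul_smul, hϖz, haz, smul_zero, smul_zero, add_zero]
    obtain ⟨y, hy⟩ := LinearMap.mem_range.mp ((Submodule.Quotient.mk_eq_zero _).mp hz0)
    refine ⟨y, hinj ?_⟩
    rw [map_smul, hy, hz]

/-- **Stub 2 (`stub_rankPropagation`) of the line `paramodular-purity-torsion-locus`**, registered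
signature verbatim.  Let `R` be a principal ideal domain, `M, N` finite free `R`-modules,
`d : M →ₗ[R] N`, `W ⊆ ℕ` and `ϖ : ℕ → R` with the `ϖ m`, `m ∈ W`, non-units and pairwise coprime.
If the two-term complex `[M --d--> N]` has a point at `ϖ m` (an `x ∉ ϖ_m M` with `d x ∈ ϖ_m N`)
for infinitely many `m ∈ W`, then it has a point at every non-unit `π ∈ R`.
Proof: if `d` were injective, `not_isCoprime_of_point` (with the torsion killer `a ≠ 0` of the
cokernel, `exists_ne_zero_smul_torsion_eq_zero`) and `false_of_infinite_not_isCoprime` contradict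
the infinitude; so `ker d ≠ ⊥` is a non-zero free module (`Submodule.basisOfPid`) and a basis
vector `e` of it is a point at every non-unit `π` (`d e = 0 = π • 0`; `e = π • y` forces `π = 0`,
absurd, or `d y = 0` by torsion-freeness of `N` and then `1 = π * (coordinate of y)`).
[folklore] -/
theorem stub_rankPropagation :
    ∀ (R : Type) [CommRing R] [IsDomain R] [IsPrincipalIdealRing R]
      (M : Type) [AddCommGroup M] [Module R M] [Module.Finite R M] [Module.Free R M]
      (N : Type) [AddCommGroup N] [Module R N] [Module.Finite R N] [Module.Free R N]
      (d : M →ₗ[R] N) (W : Set ℕ) (ϖ : ℕ → R),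
      (∀ m ∈ W, ¬ IsUnit (ϖ m)) →
      (∀ m ∈ W, ∀ m' ∈ W, m ≠ m' → IsCoprime (ϖ m) (ϖ m')) →
      Set.Infinite {m : ℕ | m ∈ W ∧ ∃ x : M, (¬ ∃ y : M, x = ϖ m • y) ∧ ∃ z : N, d x = ϖ m • z} →
      ∀ π : R, ¬ IsUnit π → ∃ x : M, (¬ ∃ y : M, x = π • y) ∧ ∃ z : N, d x = π • z := by
  intro R _ _ _ M _ _ _ _ N _ _ _ _ d W ϖ _ hcop hinf π hπ
  -- Step 1: `d` is not injective (else only finitely many `ϖ m` carry a point).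
  have hker : LinearMap.ker d ≠ ⊥ := by
    intro hbot
    have hinj : Function.Injective d := LinearMap.ker_eq_bot.mp hbot
    obtain ⟨a, ha0, ha⟩ := exists_ne_zero_smul_torsion_eq_zero R (N ⧸ LinearMap.range d)
    refine false_of_infinite_not_isCoprime ha0 (fun m hm => hm.1) hcop hinf ?_
    rintro m ⟨-, x, hx, z, hz⟩
    exact not_isCoprime_of_point hinj ha hx hz
  -- Step 2: a basis vector of the (free, non-zero) kernel is a point at every non-unit `π`.
  obtain ⟨n, bK⟩ := Submodule.basisOfPid (Module.Free.chooseBasis R M) (LinearMap.ker d)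
  haveI : Nontrivial (LinearMap.ker d) := Submodule.nontrivial_iff_ne_bot.mpr hker
  obtain ⟨i⟩ := bK.index_nonempty
  refine ⟨(bK i : M), ?_, 0, ?_⟩
  · rintro ⟨y, hy⟩
    have hdy : π • d y = 0 := by
      rw [← LinearMap.map_smul, ← hy]
      exact LinearMap.mem_ker.mp (bK i).2
    rcases eq_or_ne π 0 with h0 | h0
    · refine bK.ne_zero i (Subtype.ext ?_)
      rw [hy, h0, zero_smul, Submodule.coe_zero]
    · have hyK : y ∈ LinearMap.ker d :=
        LinearMap.mem_ker.mpr ((smul_eq_zero_iff_right h0).mp hdy)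
      have hrepr : bK i = π • (⟨y, hyK⟩ : LinearMap.ker d) := Subtype.ext hy
      have h1 := congrArg (fun v => bK.repr v i) hrepr
      simp only [Basis.repr_self, Finsupp.single_eq_same, map_smul, Finsupp.smul_apply,
        smul_eq_mul] at h1
      exact hπ (IsUnit.of_mul_eq_one _ h1.symm)
  · rw [smul_zero]
    exact LinearMap.mem_ker.mp (bK i).2

end Summit.Langlands.Langlands.Cruxes.StableYoshidaCongruence.ParamodularPurityTorsionLocus

end
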